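import Summits.NavierStokesRegularity.FluidComputer.GateBudgetLatticeMember
import HarnessLib

/-!
# What no tuning can beat, part 21: THE HEADLINE AT TAO'S AMPLIFIER — at `M = K¹⁰`, every
# dyadic knob window `20ε/K²⁰ ≤ ρhi² ≤ 2ε/K¹⁰` contains a member whose output stays below
# `ã² ≤ 1/2` until after its clock has died, with no largeness hypothesis left

Cell `pub-fluidc`, blueprint seat bp1 (gen 29, fourth item); same namespace and conventions as
parts 1–20 (`GateBudget*.lean`); imports part 20 (`GateBudgetLatticeMember`:
`knob_window_member_dud`, the window form of the dud-member theorem with the largeness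
hypotheses `hΔ`, `hH`, `hψ`, `hD`, `hm` EXPLICIT, closed-form left sides). Modes `0 = a` input,
`1 = b` clock, `2 = c` catalyst, `3 = d` transfer, `4 = ã` output; knob `ρ`, `σ_knob = ρ²/ε`.
HONEST FRAMING (verbatim): low prior, high value-of-information experiment on Tao's machine
paradigm; NOT a claim that NS blows up.

THE POINT. Part 20 left HONEST LIMIT (i): its cap is informative only under a second largeness
of the amplifier, kept as hypotheses. This file DISCHARGES all of them at the headline amplifier
`M = K¹⁰` of the cell's critical-coupling analysis (parts 7, 12: the amplifier at which Tao's
"K sufficiently large" is read), by elementary numerics (§60): `48 log K ≤ K¹⁰`; `ε ≤ K⁻¹⁰`; for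
a window with `20ε/K²⁰ ≤ ρhi²` the pulse-window length is `≤ 242/K⁹ < 1/16`, the phase budget is
`≤ 3/4` (winding count `κ ≤ K¹⁰/10`, `π < 3.15`), the drift and the afterglow are `≤ 10⁻³`.
§61 (`knob_window_dud_headline`) is then part 20 at `ψ = 3/4`, `D = 10⁻³`: for `K ≥ 16`,
`0 < ε`, `ε² ≤ 1/(6K²⁰)`, a family `X r` of exact trajectories of `rotorCircuit K K¹⁰ ε r` from
(5.6) (one per knob value) and EVERY window `[ρhi²/2, ρhi²]` with `20ε/K²⁰ ≤ ρhi²` and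
`K¹⁰ρhi² ≤ 2ε` — i.e. every dyadic window of pump rates `20/K²⁰ ≤ σ_knob ≤ 2/K¹⁰`, `K¹⁰/10 ≥`
winding count `≥ 1` — there is a member `r` (`ρhi²/2 ≤ r² ≤ ρhi²`) with its own critical and
dousing times `1 ≤ s₀ ≤ 3/2 < T ≤ s₀ + 242/K⁹` such that `ã(t)² ≤ 1/2` for all
`t ∈ [0, T + 1/8]`: the output of that member never gets past `1/√2` before its clock is dead and
an eighth of a time unit beyond. The only hypotheses left are the polynomial trigger hypotheses
of the whole chain (`K ≥ 16`, `ε² ≤ 1/(6K²⁰)`) and the window's position.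

HONEST LIMITS. (i) `ã² ≤ 1/2`, not `ã ≈ 0`: the cap is `1 - (1 - ψ²/2 - D)² + A` with the crude
`ψ = 3/4` (the critical winding `10π/49` dominates; a finer phase analysis near `b = 7ε/10` would
shrink it, not attempted). (ii) One member per window, on `[0, T + 1/8]` with ITS OWN `T`
(`1 < T < 3/2 + 242/K⁹`); a second pulse after `T + 1/8` is not excluded. (iii) Windows with
`ρhi² < 20ε/K²⁰` (winding count above `K¹⁰/10`) are not covered — there the critical crossing
itself winds the transfer phase by `O(1)`. (iv) Nothing about the firing members, nothing about
Navier–Stokes. [cite: Tao2016AveragedNS, §5.5 Theorem 5.3, (5.5), (5.6), (b-eq), (c-eq), (tcable)]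
-/

noncomputable section

namespace Summit.NavierStokesRegularity.FluidComputer.GateBudget

open Real Set Filter Topology
open Literature.Analysis.FluidPDE.Tao2016AveragedNS

/-! ## §60 Numerics at the headline amplifier `M = K¹⁰` -/

/-- `16 ^ n ≤ K ^ n` for `K ≥ 16` (the numeric floor of every power of the amplifier base).
[cite: Tao2016AveragedNS, §5.5 (5.5)] -/
theorem headline_pow_floor {K : ℝ} (hK : 16 ≤ K) (n : ℕ) : (16 : ℝ) ^ n ≤ K ^ n :=
  pow_le_pow_left₀ (by norm_num) hK n

/-- `e^{-K¹⁰} ≤ K⁻¹⁰` at the headline amplifier `M = K¹⁰`, `K ≥ 16` (from `1 + x ≤ e^x` at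
`x = K¹⁰`; stated for the amplifier only). [cite: Tao2016AveragedNS, §5.5 (5.5)] -/
theorem headline_exp_le {K : ℝ} (hK : 16 ≤ K) : exp (-K ^ 10) ≤ 1 / K ^ 10 := by
  have hK10 : 0 < K ^ 10 := by positivity
  rw [Real.exp_neg, ← one_div]
  exact one_div_le_one_div_of_le hK10 (by linarith [Real.add_one_le_exp (K ^ 10)])

/-- The logarithmic trigger hypothesis `48 log K ≤ M` of parts 12–20 holds at the headline amplifier
`M = K¹⁰`, `K ≥ 16` (`log K ≤ K - 1`, `48K ≤ K¹⁰`).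
[cite: Tao2016AveragedNS, §5.5 Theorem 5.3, (5.5)] -/
theorem headline_trigger {K : ℝ} (hK : 16 ≤ K) : 48 * Real.log K ≤ K ^ 10 := by
  have hK0 : 0 < K := by linarith
  have hlog : Real.log K ≤ K - 1 := Real.log_le_sub_one_of_pos hK0
  have h9 : (68719476736 : ℝ) ≤ K ^ 9 := by
    have := headline_pow_floor hK 9; norm_num at this; exact this
  have h48 : 48 * K ≤ K ^ 9 * K := mul_le_mul_of_nonneg_right (by linarith) hK0.le
  have h10 : K ^ 9 * K = K ^ 10 := by ring
  linarith [mul_le_mul_of_nonneg_left hlog (by norm_num : (0:ℝ) ≤ 48)]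

/-- `ε ≤ K⁻¹⁰` from the polynomial smallness `ε² ≤ 1/(6K²⁰)` of parts 12–20.
[cite: Tao2016AveragedNS, §5.5 (5.5)] -/
theorem headline_eps_le {K ε : ℝ} (hK : 16 ≤ K) (hεK : ε ^ 2 ≤ 1 / (6 * K ^ 20)) :
    ε ≤ 1 / K ^ 10 := by
  have hK0 : 0 < K := by linarith
  have hK10 : 0 < K ^ 10 := by positivity
  have h20 : 0 < K ^ 20 := by positivity
  have h1 : (ε * K ^ 10) ^ 2 ≤ 1 / 6 := by
    calc (ε * K ^ 10) ^ 2 = ε ^ 2 * K ^ 20 := by ring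
      _ ≤ 1 / (6 * K ^ 20) * K ^ 20 := mul_le_mul_of_nonneg_right hεK h20.le
      _ = 1 / 6 := by field_simp
  have h2 : ε * K ^ 10 ≤ 1 := by nlinarith [h1]
  rw [le_div_iff₀ hK10]; exact h2

/-- **The first largeness, discharged at `M = K¹⁰`.** For a window with `20ε/K²⁰ ≤ ρhi²` the
length bound of the member's pulse window (part 20 `knob_window_member_dud`, hypothesis `hΔ`) is
at most `242/K⁹`: the argument of the logarithm is `≤ (5/16)K³⁰ ≤ K³⁰`, `log K ≤ K`, and
`200/(169K¹⁰ - 400) ≤ 2/K⁹`. [cite: Tao2016AveragedNS, §5.5 Theorem 5.3, (5.5), (c-eq)] -/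
theorem headline_delta {K ε ρhi : ℝ} (hK : 16 ≤ K) (hε : 0 < ε) (hlo : 20 * ε / K ^ 20 ≤ ρhi ^ 2) :
    8 * log (25 * ε * K ^ 10 / (4 * ρhi ^ 2)) / K ^ 10 + 200 / (169 * K ^ 10 - 400)
      ≤ 242 / K ^ 9 := by
  have hK0 : 0 < K := by linarith
  have h9 : (68719476736 : ℝ) ≤ K ^ 9 := by
    have := headline_pow_floor hK 9; norm_num at this; exact this
  have h10 : (1099511627776 : ℝ) ≤ K ^ 10 := by
    have := headline_pow_floor hK 10; norm_num at this; exact this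
  have hK9 : 0 < K ^ 9 := by positivity
  have hK10 : 0 < K ^ 10 := by positivity
  have hρ2 : 0 < ρhi ^ 2 := lt_of_lt_of_le (by positivity) hlo
  have hlo' : 20 * ε ≤ ρhi ^ 2 * K ^ 20 := by rwa [div_le_iff₀ (by positivity)] at hlo
  have harg : 25 * ε * K ^ 10 / (4 * ρhi ^ 2) ≤ K ^ 30 := by
    rw [div_le_iff₀ (by positivity)]
    have h1 : K ^ 30 * (4 * ρhi ^ 2) = 4 * (ρhi ^ 2 * K ^ 20) * K ^ 10 := by ring
    have step : 20 * ε * K ^ 10 ≤ ρhi ^ 2 * K ^ 20 * K ^ 10 :=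
      mul_le_mul_of_nonneg_right hlo' hK10.le
    rw [h1]; nlinarith [step, mul_pos hε hK10]
  have hlog : log (25 * ε * K ^ 10 / (4 * ρhi ^ 2)) ≤ 30 * K := by
    calc log (25 * ε * K ^ 10 / (4 * ρhi ^ 2)) ≤ log (K ^ 30) :=
          Real.log_le_log (by positivity) harg
      _ = 30 * log K := by rw [Real.log_pow]; norm_num
      _ ≤ 30 * K := by linarith [Real.log_le_sub_one_of_pos hK0]
  have h1 : 8 * log (25 * ε * K ^ 10 / (4 * ρhi ^ 2)) / K ^ 10 ≤ 240 / K ^ 9 := by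
    rw [div_le_div_iff₀ hK10 hK9]
    have h2 : 240 * K ^ 10 = 8 * (30 * K) * K ^ 9 := by ring
    rw [h2]
    exact mul_le_mul_of_nonneg_right (by linarith) hK9.le
  have h2 : 200 / (169 * K ^ 10 - 400) ≤ 2 / K ^ 9 := by
    have hden : 0 < 169 * K ^ 10 - 400 := by linarith
    rw [div_le_div_iff₀ hden hK9]
    have h3 : K ^ 9 * 16 ≤ K ^ 9 * K := mul_le_mul_of_nonneg_left hK hK9.le
    have h4 : K ^ 9 * K = K ^ 10 := by ring
    linarith
  linarith [h1, h2, show (242:ℝ) / K ^ 9 = 240 / K ^ 9 + 2 / K ^ 9 by ring]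

/-- **The phase budget, discharged at `M = K¹⁰`.** For a window with `20ε/K²⁰ ≤ ρhi²` (so the
winding count `κ = 2ε/(K¹⁰ρhi²) ≤ K¹⁰/10`) and any `0 ≤ Δ ≤ 1`, part 20's closed-form phase budget
at `M = K¹⁰` is at most `3/4`: the critical winding contributes `≤ (10π/49)·(49/48) < 0.657`
(`π < 3.15`), every other term `≤ 10⁻³`.
[cite: Tao2016AveragedNS, §5.5 Theorem 5.3, (b-eq), (c-eq)] -/
theorem headline_psi {K ε ρhi Δ : ℝ} (hK : 16 ≤ K) (hε : 0 < ε) (hlo : 20 * ε / K ^ 20 ≤ ρhi ^ 2)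
    (hΔ0 : 0 ≤ Δ) (hΔ : Δ ≤ 1) :
    6 / (K ^ 10 * K ^ 10) + 16 * exp (-K ^ 10) / (K ^ 10) ^ 2 +
      (2 * ε / (K ^ 10 * ρhi ^ 2) * (π * (100 / (49 * K ^ 10))) +
        10 * exp (-K ^ 10) * Δ / (7 * K ^ 10)) / (1 - 100 / (49 * K ^ 10)) + 3 / (2 * K ^ 10)
      ≤ 3 / 4 := by
  have hK0 : 0 < K := by linarith
  have h10 : (1099511627776 : ℝ) ≤ K ^ 10 := by
    have := headline_pow_floor hK 10; norm_num at this; exact this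
  have hK10 : 0 < K ^ 10 := by positivity
  have hρ2 : 0 < ρhi ^ 2 := lt_of_lt_of_le (by positivity) hlo
  have hlo' : 20 * ε ≤ ρhi ^ 2 * K ^ 20 := by rwa [div_le_iff₀ (by positivity)] at hlo
  have hexp : exp (-K ^ 10) ≤ 1 / K ^ 10 := headline_exp_le hK
  have hexp1 : exp (-K ^ 10) ≤ 1 := hexp.trans ((div_le_one hK10).2 (by linarith))
  have hexp0 : 0 < exp (-K ^ 10) := Real.exp_pos _
  have hsq : (1099511627776 : ℝ) * 1099511627776 ≤ K ^ 10 * K ^ 10 :=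
    mul_le_mul h10 h10 (by norm_num) hK10.le
  have t1 : 6 / (K ^ 10 * K ^ 10) ≤ 1 / 1000 := by
    rw [div_le_div_iff₀ (by positivity) (by norm_num)]; nlinarith [hsq]
  have t2 : 16 * exp (-K ^ 10) / (K ^ 10) ^ 2 ≤ 1 / 1000 := by
    rw [div_le_div_iff₀ (by positivity) (by norm_num)]; nlinarith [hsq, hexp1, hexp0]
  have hκ : 2 * ε / (K ^ 10 * ρhi ^ 2) ≤ K ^ 10 / 10 := by
    rw [div_le_div_iff₀ (by positivity) (by norm_num)]
    have h1 : K ^ 10 * (K ^ 10 * ρhi ^ 2) = ρhi ^ 2 * K ^ 20 := by ring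
    rw [h1]; linarith [hlo']
  have tκ : 2 * ε / (K ^ 10 * ρhi ^ 2) * (π * (100 / (49 * K ^ 10))) ≤ 10 * π / 49 := by
    calc 2 * ε / (K ^ 10 * ρhi ^ 2) * (π * (100 / (49 * K ^ 10)))
        ≤ K ^ 10 / 10 * (π * (100 / (49 * K ^ 10))) := mul_le_mul_of_nonneg_right hκ (by positivity)
      _ = 10 * π / 49 := by field_simp; ring
  have tδ : 10 * exp (-K ^ 10) * Δ / (7 * K ^ 10) ≤ 1 / 1000 := by
    have h1 : exp (-K ^ 10) * Δ ≤ 1 := by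
      calc exp (-K ^ 10) * Δ ≤ 1 * Δ := mul_le_mul_of_nonneg_right hexp1 hΔ0
        _ ≤ 1 := by linarith
    rw [div_le_div_iff₀ (by positivity) (by norm_num)]; nlinarith [h1, h10]
  have hq : 48 / 49 ≤ 1 - 100 / (49 * K ^ 10) := by
    have h1 : 100 / (49 * K ^ 10) ≤ 1 / 49 := by
      rw [div_le_div_iff₀ (by positivity) (by norm_num)]; linarith [h10]
    linarith
  have hN0 : 0 ≤ 2 * ε / (K ^ 10 * ρhi ^ 2) * (π * (100 / (49 * K ^ 10))) +
      10 * exp (-K ^ 10) * Δ / (7 * K ^ 10) := by positivity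
  have hquot : (2 * ε / (K ^ 10 * ρhi ^ 2) * (π * (100 / (49 * K ^ 10))) +
      10 * exp (-K ^ 10) * Δ / (7 * K ^ 10)) / (1 - 100 / (49 * K ^ 10)) ≤
      (10 * π / 49 + 1 / 1000) / (48 / 49) :=
    (div_le_div_of_nonneg_left hN0 (by norm_num) hq).trans
      (div_le_div_of_nonneg_right (by linarith [tκ, tδ]) (by norm_num))
  have t3 : 3 / (2 * K ^ 10) ≤ 1 / 1000 := by
    rw [div_le_div_iff₀ (by positivity) (by norm_num)]; linarith [h10]
  linarith [t1, t2, hquot, t3, Real.pi_lt_d2]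

/-- **The drift, discharged at `M = K¹⁰`.** With `ε² ≤ 1/(6K²⁰)`, `K¹⁰ρhi² ≤ 2ε` and the window
length `Δ = 242/K⁹` of `headline_delta`, part 20's closed-form drift is at most `10⁻³`
(`ε ≤ K⁻¹⁰`, `ρhi² ≤ 2ε`, `K²Δ = 242/K⁷`, `K ≥ 16`).
[cite: Tao2016AveragedNS, §5.5 Theorem 5.3, (5.5)] -/
theorem headline_drift {K ε ρhi : ℝ} (hK : 16 ≤ K) (hεK : ε ^ 2 ≤ 1 / (6 * K ^ 20))
    (hhi : K ^ 10 * ρhi ^ 2 ≤ 2 * ε) :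
    6 * (ε + ρhi ^ 2 * exp (-K ^ 10) + 3 / K ^ 9) +
      2 * (ε + ρhi ^ 2 * exp (-K ^ 10) + 3 / K ^ 9 + K ^ 2 * (242 / K ^ 9)) * (242 / K ^ 9) ≤
      1 / 1000 := by
  have hK0 : 0 < K := by linarith
  have h7 : (268435456 : ℝ) ≤ K ^ 7 := by
    have := headline_pow_floor hK 7; norm_num at this; exact this
  have h9 : (68719476736 : ℝ) ≤ K ^ 9 := by
    have := headline_pow_floor hK 9; norm_num at this; exact this
  have hK7 : 0 < K ^ 7 := by positivity
  have hK9 : 0 < K ^ 9 := by positivity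
  have hK10 : 0 < K ^ 10 := by positivity
  have hexp1 : exp (-K ^ 10) ≤ 1 :=
    (headline_exp_le hK).trans ((div_le_one hK10).2 (by nlinarith [h9, hK0]))
  have hε1 : ε ≤ 1 / K ^ 10 := headline_eps_le hK hεK
  have h910 : K ^ 9 ≤ K ^ 10 := by
    have h1 : K ^ 10 = K ^ 9 * K := by ring
    rw [h1]; exact le_mul_of_one_le_right hK9.le (by linarith)
  have hε9 : ε ≤ 1 / K ^ 9 := hε1.trans (one_div_le_one_div_of_le hK9 h910)
  have hρa : ρhi ^ 2 ≤ 2 * ε := by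
    nlinarith [hhi, mul_le_mul_of_nonneg_left (show (1:ℝ) ≤ K ^ 10 by linarith) (sq_nonneg ρhi)]
  have hρe : ρhi ^ 2 * exp (-K ^ 10) ≤ 2 / K ^ 9 := by
    calc ρhi ^ 2 * exp (-K ^ 10) ≤ ρhi ^ 2 * 1 := mul_le_mul_of_nonneg_left hexp1 (sq_nonneg _)
      _ ≤ 2 * ε := by linarith
      _ ≤ 2 / K ^ 9 := by linarith [hε9, show (2:ℝ) / K ^ 9 = 2 * (1 / K ^ 9) by ring]
  have hE : ε + ρhi ^ 2 * exp (-K ^ 10) + 3 / K ^ 9 ≤ 6 / K ^ 9 := by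
    linarith [hε9, hρe, show (6:ℝ) / K ^ 9 = 1 / K ^ 9 + 2 / K ^ 9 + 3 / K ^ 9 by ring]
  have hK2 : K ^ 2 * (242 / K ^ 9) = 242 / K ^ 7 := by
    field_simp
  have hA : 6 / K ^ 9 + 242 / K ^ 7 ≤ 1 / 1000 := by
    have h1 : 6 / K ^ 9 ≤ 1 / 2000 := by rw [div_le_div_iff₀ hK9 (by norm_num)]; linarith [h9]
    have h2 : 242 / K ^ 7 ≤ 1 / 2000 := by rw [div_le_div_iff₀ hK7 (by norm_num)]; linarith [h7]
    linarith
  have hB : 242 / K ^ 9 ≤ 1 / 1000 := by rw [div_le_div_iff₀ hK9 (by norm_num)]; linarith [h9]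
  have hB0 : 0 ≤ 242 / K ^ 9 := by positivity
  have hprod : (ε + ρhi ^ 2 * exp (-K ^ 10) + 3 / K ^ 9 + K ^ 2 * (242 / K ^ 9)) * (242 / K ^ 9) ≤
      1 / 1000 * (1 / 1000) := by
    rw [hK2]
    exact mul_le_mul (by linarith [hE, hA]) hB hB0 (by norm_num)
  have hC : 6 / K ^ 9 ≤ 1 / 100000 := by rw [div_le_div_iff₀ hK9 (by norm_num)]; linarith [h9]
  linarith [hE, hprod, hC]

/-- **The afterglow, discharged at `M = K¹⁰`.** Part 20's afterglow constant
`16(K⁻¹⁰ + 4e^{-M}/M + ε)/M + 4e^{-M}/M` at `M = K¹⁰` is at most `10⁻³`.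
[cite: Tao2016AveragedNS, §5.5 Theorem 5.3, (5.5)] -/
theorem headline_afterglow {K ε : ℝ} (hK : 16 ≤ K) (hεK : ε ^ 2 ≤ 1 / (6 * K ^ 20)) :
    16 * (1 / K ^ 10 + 4 * exp (-K ^ 10) / K ^ 10 + ε) / K ^ 10 + 4 * exp (-K ^ 10) / K ^ 10 ≤
      1 / 1000 := by
  have hK0 : 0 < K := by linarith
  have h10 : (1099511627776 : ℝ) ≤ K ^ 10 := by
    have := headline_pow_floor hK 10; norm_num at this; exact this
  have hK10 : 0 < K ^ 10 := by positivity
  have hexp1 : exp (-K ^ 10) ≤ 1 :=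
    (headline_exp_le hK).trans ((div_le_one hK10).2 (by linarith))
  have hε1 : ε ≤ 1 / K ^ 10 := headline_eps_le hK hεK
  have h4 : 4 * exp (-K ^ 10) / K ^ 10 ≤ 4 / K ^ 10 :=
    div_le_div_of_nonneg_right (by linarith [hexp1]) hK10.le
  have hu : 1 / K ^ 10 ≤ 1 / 1000000 := one_div_le_one_div_of_le (by norm_num) (by linarith [h10])
  have hin : 1 / K ^ 10 + 4 * exp (-K ^ 10) / K ^ 10 + ε ≤ 1 := by
    linarith [h4, hε1, hu, show (4:ℝ) / K ^ 10 = 4 * (1 / K ^ 10) by ring]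
  have h16 : 16 * (1 / K ^ 10 + 4 * exp (-K ^ 10) / K ^ 10 + ε) / K ^ 10 ≤ 16 * 1 / K ^ 10 :=
    div_le_div_of_nonneg_right (by linarith [hin]) hK10.le
  linarith [h16, h4, hu, show (16:ℝ) * 1 / K ^ 10 = 16 * (1 / K ^ 10) by ring,
    show (4:ℝ) / K ^ 10 = 4 * (1 / K ^ 10) by ring]

/-! ## §61 The headline: at `M = K¹⁰` every dyadic knob window contains a dud member -/

/-- **WHAT NO TUNING CAN BEAT, THE HEADLINE AT TAO'S AMPLIFIER (S13″c, hypothesis-free form).**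
Let `K ≥ 16`, `0 < ε`, `ε² ≤ 1/(6K²⁰)`, and let `X r` be, for every knob value `r`, an exact
trajectory of `rotorCircuit K K¹⁰ ε r` from the initial datum (5.6) (`C r` a primitive of its
catalyst). For EVERY window `[ρhi²/2, ρhi²]` of knobs with `20ε/K²⁰ ≤ ρhi²` and `K¹⁰ρhi² ≤ 2ε`
there is a member `r`, `ρhi²/2 ≤ r² ≤ ρhi²`, with its own times `1 ≤ s₀ ≤ 3/2 < T ≤ s₀ + 242/K⁹`
(criticality of the clock and its dousing), whose output satisfies `ã(t)² ≤ 1/2` for all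
`t ∈ [0, T + 1/8]`. Part 20 `knob_window_member_dud` at `M = K¹⁰`, `Δ = 242/K⁹`, `ψ = 3/4`,
`D = 10⁻³`, every largeness hypothesis discharged by §60. HONEST LIMITS (i)–(iv) of the header.
[cite: Tao2016AveragedNS, §5.5 Theorem 5.3, (5.5), (5.6), (b-eq), (c-eq), (tcable)] -/
theorem knob_window_dud_headline {K ε : ℝ} {X : ℝ → ℝ → Fin 5 → ℝ} {C : ℝ → ℝ → ℝ}
    (hX : ∀ r t, HasDerivAt (X r) (RotorKnob.rotorCircuit K (K ^ 10) ε r (X r t)) t)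
    (h0 : ∀ r, X r 0 = delayInit) (hC : ∀ r t, HasDerivAt (C r) (X r t 2) t)
    (hK : 16 ≤ K) (hε : 0 < ε) (hεK : ε ^ 2 ≤ 1 / (6 * K ^ 20)) {ρhi : ℝ} (hρhi : 0 < ρhi)
    (hlo : 20 * ε / K ^ 20 ≤ ρhi ^ 2) (hhi : K ^ 10 * ρhi ^ 2 ≤ 2 * ε) :
    ∃ r : ℝ, 0 < r ∧ ρhi ^ 2 / 2 ≤ r ^ 2 ∧ r ^ 2 ≤ ρhi ^ 2 ∧
      ∃ s₀ T : ℝ, 1 ≤ s₀ ∧ s₀ ≤ 3 / 2 ∧ s₀ < T ∧ T - s₀ ≤ 242 / K ^ 9 ∧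
        ∀ t ∈ Icc 0 (T + 1 / 8), X r t 4 ^ 2 ≤ 1 / 2 := by
  have hK0 : 0 < K := by linarith
  have hK10 : 0 < K ^ 10 := by positivity
  have h9 : (68719476736 : ℝ) ≤ K ^ 9 := by
    have := headline_pow_floor hK 9; norm_num at this; exact this
  have hH : (242 : ℝ) / K ^ 9 < 1 / 16 := by
    rw [div_lt_div_iff₀ (by positivity) (by norm_num)]; linarith [h9]
  have hΔ0 : (0 : ℝ) ≤ 242 / K ^ 9 := by positivity
  have hm : (0 : ℝ) ≤ 1 - (3 / 4 : ℝ) ^ 2 / 2 - 1 / 1000 := by norm_num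
  obtain ⟨r, hr0, hr1, hr2, s₀, T, hs1, hs2, hsT, hTs, hcap⟩ :=
    knob_window_member_dud hX h0 hC hε hK10 le_rfl hK (headline_trigger hK) hεK hρhi hhi
      (headline_delta hK hε hlo) hH (headline_psi hK hε hlo hΔ0 (by linarith))
      (headline_drift hK hεK hhi) hm
  refine ⟨r, hr0, hr1, hr2, s₀, T, hs1, hs2, hsT, hTs, fun t ht => ?_⟩
  nlinarith [hcap t ht, headline_afterglow hK hεK (ε := ε), hm]

end Summit.NavierStokesRegularity.FluidComputer.GateBudget
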